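import Summits.PneNP.PneNP.Theses.PrimalityPlaces
import HarnessLib.Audit.CruxProbe

/-! BC7 deterministic crux probe for the two open load-bearing binders of `closes` (route-PneNP-PrimalityPlaces). -/

#h21_crux_probe Summit.PneNP.PneNP.Theses.PrimalityPlaces.EFPrimalityHard route := "route-PneNP-PrimalityPlaces"

#h21_crux_probe Summit.PneNP.PneNP.Theses.PrimalityPlaces.EFPrimalityReachesX route := "route-PneNP-PrimalityPlaces"
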